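import Mathlib
import HarnessLib
import Summits.HubbardSuperconductivity.HubbardSuperconductivity.Theorems.KLProgrammeKLRegimeTwoVolumeLipDefectDefs
import Summits.HubbardSuperconductivity.HubbardSuperconductivity.Theorems.KLProgrammeKLRegimeTwoVolumeBlockDefect

/-!
# Route `KLProgramme` — crux K3 ENGINE (stmt-HubbardSuperconductivity-20437), stub (e) proof-input «(e)-D-ROWS», F-D5b (sizes): THE NEAR AND FAR PIECES OF
# THE BLOCK COVARIANCE DEFECT ARE SMALL / BOUNDED — `…TwoVolumeBlockDefect` at the objects of `…TwoVolumeLipDefectDefs`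
# (seat hubbard-kl-k3c4-p1 g23; `--supports` 20437; DROWS-SCOPE-g23 §9.4 F-D5b)

`…TwoVolumeBlockDefect` (route A g7, generic) bounds the near piece `D_n` of a covariance defect `C′ − C^cop = D_n + D_f` by the far row TAIL of `C′`
(periodisation (P) + torus geometry (G1)/(G2)) and the far piece `D_f` by sups and rows.  Here every structural hypothesis is DISCHARGED at block `k` of the
two-volume Lipschitz tower: `C′ := klLipCov (bL) … d k`, `C := klLipCov L … d k`, `C^cop := klCopiesCov (klLipCov L …)` (`klCopiesCov_apply`), the zone
`Zs := {not R-deep}` (`klDeepPins`), `D_n := klLipDefectNear … R`, `D_f := klLipDefectFar … R` (`klLipDefectNear_apply/Far_apply`), (P) := `klLipCov_periodise`,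
(G1)/(G2) := `sector_far_of_block_ne/_fibre_ne` at the canonical block structure (`klBlockEquiv_val/_snd`), antisymmetry := `sectorPullback_swap` (through
`hubbardCovSliceCT_eq_normalCovariance_sliceSymbolFnXi`), `Far X′ Y′ := R < tnorm (site X′ − site Y′)`.  What remains are ONE-VOLUME decay data of the block
covariances: the far row tail `T` of `C′_{bL}` (`Σ_{R < tnorm(x′−y′)} ‖C′ X′ Y′‖ ≤ T`, a first moment over `R`), sups `s′, s` and rows `α′, α`:

* **`klLipDefectNear_norm_le`** (`‖D_n X′ Y′‖ ≤ T`), **`klLipDefectNear_row_le`** / **`_col_le`** (`≤ 2T`);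
* `klLipDefectFar_norm_le` (`≤ s′ + s`), `klLipDefectFar_row_le` / `_col_le` (`≤ α′ + α`); `klLipCov_swap` (antisymmetry of the block covariances).

These are the `κ_n`-side inputs (`sn := T`, `αn := 2T`; Gram data in the sequel) and the `D_f` sizes (`sD := s′+s`, `αf := α′+α`) of
`…TwoVolumeDefectStepGraded.sum_norm_kernel_twoVolumeDefect_le_graded` at the source defect (`lipSourceDefect_eq_defectStep`).  Compositions of landed theorems;
nothing about the model's decay is asserted (the tails/sups/rows are hypotheses); nothing asserts the (D) rows, stub (e), VL, K3 or superconductivity.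
References: BGM 2006 §2 (2.13)–(2.14), (2.80); Salmhofer 1999 (2.102)–(2.106) [cite: BenfattoGiulianiMastropietro2006].
-/

noncomputable section

namespace Summit.HubbardSuperconductivity.HubbardSuperconductivity.Theorems.TwoVolumeLip

set_option linter.dupNamespace false -- summit = problem name (single-conjunct summit), D-0017

open Finset Literature.MathematicalPhysics.QuantumLattice GrassmannAlgebra Literature.Probability.LatticeModels
open Literature.MathematicalPhysics.QuantumLattice.FermiRG
open Summit.HubbardSuperconductivity.HubbardSuperconductivity.Theorems.KLRegimeSplit
open Summit.HubbardSuperconductivity.HubbardSuperconductivity.Theorems.KLProgrammeLegKernels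
open Summit.HubbardSuperconductivity.HubbardSuperconductivity.Theorems.DispersionFlow
open Summit.HubbardSuperconductivity.HubbardSuperconductivity.Theorems.EngineV8
open Summit.HubbardSuperconductivity.HubbardSuperconductivity.Theorems.TwoVolumeSource
open Summit.HubbardSuperconductivity.HubbardSuperconductivity.Theorems.TwoVolumeDefect
open Summit.HubbardSuperconductivity.HubbardSuperconductivity.Theorems.TwoPointAssembly
open Summit.HubbardSuperconductivity.HubbardSuperconductivity.Theorems.TorusFourierL2

variable {L b M : ℕ} [NeZero L] [NeZero (b * L)]

/-! ## §1 The structural hypotheses of `…TwoVolumeBlockDefect` at the block objects -/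

/-- The copies covariance in the `hCcop` shape. -/
theorem klCopiesCov_klLipCov_apply (β μ : ℝ) (K : TrigPolyC4v) (d k : ℕ) (X' Y' : SpaceTimeIdx (b * L) M × SectorLeg (sectorCount (d * k - 1))) :
    klCopiesCov L b M (sectorCount (d * k - 1)) (klLipCov L M β μ K d k) X' Y' =
      if (klBlockEquiv L b M (sectorCount (d * k - 1)) X').1 = (klBlockEquiv L b M (sectorCount (d * k - 1)) Y').1 then
        klLipCov L M β μ K d k (klBlockEquiv L b M (sectorCount (d * k - 1)) X').2 (klBlockEquiv L b M (sectorCount (d * k - 1)) Y').2 else 0 :=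
  klCopiesCov_apply _ X' Y'

/-- The near piece in the `hDn` shape, zone `{not R-deep}`. -/
theorem klLipDefectNear_apply' (β μ : ℝ) (K : TrigPolyC4v) (d k R : ℕ) (X' Y' : SpaceTimeIdx (b * L) M × SectorLeg (sectorCount (d * k - 1))) :
    klLipDefectNear L b M β μ K d k R X' Y' =
      if X' ∈ {Z' : SpaceTimeIdx (b * L) M × SectorLeg (sectorCount (d * k - 1)) | Z' ∉ klDeepPins L R} ∧
          Y' ∈ {Z' : SpaceTimeIdx (b * L) M × SectorLeg (sectorCount (d * k - 1)) | Z' ∉ klDeepPins L R} then 0 else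
        klLipCov (b * L) M β μ K d k X' Y' - klCopiesCov L b M (sectorCount (d * k - 1)) (klLipCov L M β μ K d k) X' Y' :=
  klLipDefectNear_apply β μ K d k R X' Y'

/-- The far piece in the `hDf` shape, zone `{not R-deep}`. -/
theorem klLipDefectFar_apply' (β μ : ℝ) (K : TrigPolyC4v) (d k R : ℕ) (X' Y' : SpaceTimeIdx (b * L) M × SectorLeg (sectorCount (d * k - 1))) :
    klLipDefectFar L b M β μ K d k R X' Y' =
      if X' ∈ {Z' : SpaceTimeIdx (b * L) M × SectorLeg (sectorCount (d * k - 1)) | Z' ∉ klDeepPins L R} ∧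
          Y' ∈ {Z' : SpaceTimeIdx (b * L) M × SectorLeg (sectorCount (d * k - 1)) | Z' ∉ klDeepPins L R} then
        klLipCov (b * L) M β μ K d k X' Y' - klCopiesCov L b M (sectorCount (d * k - 1)) (klLipCov L M β μ K d k) X' Y' else 0 :=
  klLipDefectFar_apply β μ K d k R X' Y'

/-- (P) in the `hP` shape (`klLipCov_periodise`). -/
theorem klLipCov_periodise' [NeZero M] {β : ℝ} (hβ : β ≠ 0) (μ : ℝ) (K : TrigPolyC4v) (d k : ℕ)
    (X' : SpaceTimeIdx (b * L) M × SectorLeg (sectorCount (d * k - 1))) (Y : SpaceTimeIdx L M × SectorLeg (sectorCount (d * k - 1))) :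
    ∑ Y'' ∈ univ.filter (fun Y'' : SpaceTimeIdx (b * L) M × SectorLeg (sectorCount (d * k - 1)) =>
        (klBlockEquiv L b M (sectorCount (d * k - 1)) Y'').2 = Y), klLipCov (b * L) M β μ K d k X' Y'' =
      klLipCov L M β μ K d k (klBlockEquiv L b M (sectorCount (d * k - 1)) X').2 Y :=
  klLipCov_periodise hβ μ K d k X' Y

/-- (G1) at the canonical block structure, zone `{not R-deep}`, `Far := R < tnorm (site − site)`. -/
theorem lip_far_of_block_ne (d k R : ℕ) {X' Y' : SpaceTimeIdx (b * L) M × SectorLeg (sectorCount (d * k - 1))}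
    (hne : (klBlockEquiv L b M (sectorCount (d * k - 1)) X').1 ≠ (klBlockEquiv L b M (sectorCount (d * k - 1)) Y').1)
    (hnz : ¬ (X' ∈ {Z' : SpaceTimeIdx (b * L) M × SectorLeg (sectorCount (d * k - 1)) | Z' ∉ klDeepPins L R} ∧
            Y' ∈ {Z' : SpaceTimeIdx (b * L) M × SectorLeg (sectorCount (d * k - 1)) | Z' ∉ klDeepPins L R})) :
    R < Torus.tnorm (X'.1.2 - Y'.1.2) := by
  refine sector_far_of_block_ne (Lf := b * L) (b := b) (L := L) rfl (klBlockEquiv L b M (sectorCount (d * k - 1)))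
    (klBlockEquiv_val L b M (sectorCount (d * k - 1))) hne ?_
  simpa only [Set.mem_setOf_eq, mem_klDeepPins] using hnz

/-- (G2) at the canonical block structure. -/
theorem lip_far_of_fibre_ne (d k R : ℕ) {X' Y' Y'' : SpaceTimeIdx (b * L) M × SectorLeg (sectorCount (d * k - 1))}
    (hblk : (klBlockEquiv L b M (sectorCount (d * k - 1)) X').1 = (klBlockEquiv L b M (sectorCount (d * k - 1)) Y').1)
    (hfib : (klBlockEquiv L b M (sectorCount (d * k - 1)) Y'').2 = (klBlockEquiv L b M (sectorCount (d * k - 1)) Y').2) (hne : Y'' ≠ Y')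
    (hnz : ¬ (X' ∈ {Z' : SpaceTimeIdx (b * L) M × SectorLeg (sectorCount (d * k - 1)) | Z' ∉ klDeepPins L R} ∧
            Y' ∈ {Z' : SpaceTimeIdx (b * L) M × SectorLeg (sectorCount (d * k - 1)) | Z' ∉ klDeepPins L R})) :
    R < Torus.tnorm (X'.1.2 - Y''.1.2) := by
  refine sector_far_of_fibre_ne (Lf := b * L) (b := b) (L := L) rfl (klBlockEquiv L b M (sectorCount (d * k - 1)))
    (klBlockEquiv_val L b M (sectorCount (d * k - 1))) (klBlockEquiv_snd L b M (sectorCount (d * k - 1))) hblk hfib hne ?_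
  simpa only [Set.mem_setOf_eq, mem_klDeepPins] using hnz

/-- **The block covariances are antisymmetric** (fermionic): `klLipCov V … Y X = − klLipCov V … X Y` (`β ≠ 0`). -/
theorem klLipCov_swap {V : ℕ} [NeZero V] {β : ℝ} (hβ : β ≠ 0) (μ : ℝ) (K : TrigPolyC4v) (d k : ℕ)
    (X Y : SpaceTimeIdx V M × SectorLeg (sectorCount (d * k - 1))) :
    klLipCov V M β μ K d k Y X = -klLipCov V M β μ K d k X Y := by
  rw [klLipCov_def, hubbardCovSliceCT_eq_normalCovariance_sliceSymbolFnXi hβ]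
  exact sectorPullback_swap β _ _ X Y

/-! ## §2 Sizes of the near piece: the far row tail of the fine block covariance -/

/-- **NEAR ENTRIES ARE TAIL-SMALL**: `‖klLipDefectNear … R X′ Y′‖ ≤ T` for a bound `T` on the far row tails `Σ_{R < tnorm(x′−y′)} ‖klLipCov (bL) X′ Y′‖` (`β ≠ 0`). -/
theorem klLipDefectNear_norm_le [NeZero M] {β : ℝ} (hβ : β ≠ 0) (μ : ℝ) (K : TrigPolyC4v) (d k R : ℕ) {T : ℝ}
    (hT : ∀ X' : SpaceTimeIdx (b * L) M × SectorLeg (sectorCount (d * k - 1)),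
      ∑ Y' ∈ univ.filter (fun Y' : SpaceTimeIdx (b * L) M × SectorLeg (sectorCount (d * k - 1)) => R < Torus.tnorm (X'.1.2 - Y'.1.2)),
        ‖klLipCov (b * L) M β μ K d k X' Y'‖ ≤ T)
    (X' Y' : SpaceTimeIdx (b * L) M × SectorLeg (sectorCount (d * k - 1))) :
    ‖klLipDefectNear L b M β μ K d k R X' Y'‖ ≤ T := by
  classical
  exact norm_near_le (klBlockEquiv L b M (sectorCount (d * k - 1))) (klLipCov L M β μ K d k) (klLipCov (b * L) M β μ K d k)
    (klCopiesCov L b M (sectorCount (d * k - 1)) (klLipCov L M β μ K d k)) (klLipDefectNear L b M β μ K d k R)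
    {Z' | Z' ∉ klDeepPins L R} (klCopiesCov_klLipCov_apply β μ K d k) (klLipDefectNear_apply' β μ K d k R) (klLipCov_periodise' hβ μ K d k)
    (fun X' Y' => R < Torus.tnorm (X'.1.2 - Y'.1.2)) (fun X' Y' h1 h2 => lip_far_of_block_ne d k R h1 h2)
    (fun X' Y' Y'' h1 h2 h3 h4 => lip_far_of_fibre_ne d k R h1 h2 h3 h4) hT X' Y'

/-- **NEAR ROWS ARE TAIL-SMALL**: `Σ_{Y′} ‖klLipDefectNear … R X′ Y′‖ ≤ 2T`. -/
theorem klLipDefectNear_row_le [NeZero M] {β : ℝ} (hβ : β ≠ 0) (μ : ℝ) (K : TrigPolyC4v) (d k R : ℕ) {T : ℝ}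
    (hT : ∀ X' : SpaceTimeIdx (b * L) M × SectorLeg (sectorCount (d * k - 1)),
      ∑ Y' ∈ univ.filter (fun Y' : SpaceTimeIdx (b * L) M × SectorLeg (sectorCount (d * k - 1)) => R < Torus.tnorm (X'.1.2 - Y'.1.2)),
        ‖klLipCov (b * L) M β μ K d k X' Y'‖ ≤ T)
    (X' : SpaceTimeIdx (b * L) M × SectorLeg (sectorCount (d * k - 1))) :
    ∑ Y', ‖klLipDefectNear L b M β μ K d k R X' Y'‖ ≤ 2 * T := by
  classical
  exact sum_norm_near_row_le (klBlockEquiv L b M (sectorCount (d * k - 1))) (klLipCov L M β μ K d k) (klLipCov (b * L) M β μ K d k)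
    (klCopiesCov L b M (sectorCount (d * k - 1)) (klLipCov L M β μ K d k)) (klLipDefectNear L b M β μ K d k R)
    {Z' | Z' ∉ klDeepPins L R} (klCopiesCov_klLipCov_apply β μ K d k) (klLipDefectNear_apply' β μ K d k R) (klLipCov_periodise' hβ μ K d k)
    (fun X' Y' => R < Torus.tnorm (X'.1.2 - Y'.1.2)) (fun X' Y' h1 h2 => lip_far_of_block_ne d k R h1 h2)
    (fun X' Y' Y'' h1 h2 h3 h4 => lip_far_of_fibre_ne d k R h1 h2 h3 h4) hT X'

/-- **NEAR COLUMNS ARE TAIL-SMALL**: `Σ_{X′} ‖klLipDefectNear … R X′ Y′‖ ≤ 2T` (antisymmetry of both block covariances). -/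
theorem klLipDefectNear_col_le [NeZero M] {β : ℝ} (hβ : β ≠ 0) (μ : ℝ) (K : TrigPolyC4v) (d k R : ℕ) {T : ℝ}
    (hT : ∀ X' : SpaceTimeIdx (b * L) M × SectorLeg (sectorCount (d * k - 1)),
      ∑ Y' ∈ univ.filter (fun Y' : SpaceTimeIdx (b * L) M × SectorLeg (sectorCount (d * k - 1)) => R < Torus.tnorm (X'.1.2 - Y'.1.2)),
        ‖klLipCov (b * L) M β μ K d k X' Y'‖ ≤ T)
    (Y' : SpaceTimeIdx (b * L) M × SectorLeg (sectorCount (d * k - 1))) :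
    ∑ X', ‖klLipDefectNear L b M β μ K d k R X' Y'‖ ≤ 2 * T := by
  classical
  exact sum_norm_near_col_le (klBlockEquiv L b M (sectorCount (d * k - 1))) (klLipCov L M β μ K d k) (klLipCov (b * L) M β μ K d k)
    (klCopiesCov L b M (sectorCount (d * k - 1)) (klLipCov L M β μ K d k)) (klLipDefectNear L b M β μ K d k R)
    {Z' | Z' ∉ klDeepPins L R} (klCopiesCov_klLipCov_apply β μ K d k) (klLipDefectNear_apply' β μ K d k R) (klLipCov_periodise' hβ μ K d k)
    (fun X' Y' => klLipCov_swap hβ μ K d k X' Y') (fun X Y => klLipCov_swap hβ μ K d k X Y)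
    (fun X' Y' => R < Torus.tnorm (X'.1.2 - Y'.1.2)) (fun X' Y' h1 h2 => lip_far_of_block_ne d k R h1 h2)
    (fun X' Y' Y'' h1 h2 h3 h4 => lip_far_of_fibre_ne d k R h1 h2 h3 h4) hT Y'

/-! ## §3 Sizes of the far piece: sups and rows of the two block covariances -/

/-- **Far entries**: `‖klLipDefectFar … R X′ Y′‖ ≤ s′ + s` for sups `s′` of `klLipCov (bL)` and `s` of `klLipCov L`. -/
theorem klLipDefectFar_norm_le (β μ : ℝ) (K : TrigPolyC4v) (d k R : ℕ) {s' s : ℝ} (hs'0 : 0 ≤ s') (hs0 : 0 ≤ s)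
    (hs' : ∀ X' Y', ‖klLipCov (b * L) M β μ K d k X' Y'‖ ≤ s') (hs : ∀ X Y, ‖klLipCov L M β μ K d k X Y‖ ≤ s)
    (X' Y' : SpaceTimeIdx (b * L) M × SectorLeg (sectorCount (d * k - 1))) :
    ‖klLipDefectFar L b M β μ K d k R X' Y'‖ ≤ s' + s := by
  classical
  exact norm_far_le (klBlockEquiv L b M (sectorCount (d * k - 1))) (klLipCov L M β μ K d k) (klLipCov (b * L) M β μ K d k)
    (klCopiesCov L b M (sectorCount (d * k - 1)) (klLipCov L M β μ K d k)) (klLipDefectFar L b M β μ K d k R)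
    {Z' | Z' ∉ klDeepPins L R} (klCopiesCov_klLipCov_apply β μ K d k) (klLipDefectFar_apply' β μ K d k R) hs'0 hs0 hs' hs X' Y'

/-- **Far rows**: `Σ_{Y′} ‖klLipDefectFar … R X′ Y′‖ ≤ α′ + α` for rows `α′` of `klLipCov (bL)` and `α` of `klLipCov L`. -/
theorem klLipDefectFar_row_le (β μ : ℝ) (K : TrigPolyC4v) (d k R : ℕ) {α' α : ℝ}
    (hrow' : ∀ X', ∑ Y', ‖klLipCov (b * L) M β μ K d k X' Y'‖ ≤ α') (hrow : ∀ X, ∑ Y, ‖klLipCov L M β μ K d k X Y‖ ≤ α)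
    (X' : SpaceTimeIdx (b * L) M × SectorLeg (sectorCount (d * k - 1))) :
    ∑ Y', ‖klLipDefectFar L b M β μ K d k R X' Y'‖ ≤ α' + α := by
  classical
  exact sum_norm_far_row_le (klBlockEquiv L b M (sectorCount (d * k - 1))) (klLipCov L M β μ K d k) (klLipCov (b * L) M β μ K d k)
    (klCopiesCov L b M (sectorCount (d * k - 1)) (klLipCov L M β μ K d k)) (klLipDefectFar L b M β μ K d k R)
    {Z' | Z' ∉ klDeepPins L R} (klCopiesCov_klLipCov_apply β μ K d k) (klLipDefectFar_apply' β μ K d k R) hrow' hrow X'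

/-- **Far columns**: `Σ_{X′} ‖klLipDefectFar … R X′ Y′‖ ≤ α′ + α` for columns `α′` of `klLipCov (bL)` and `α` of `klLipCov L`. -/
theorem klLipDefectFar_col_le (β μ : ℝ) (K : TrigPolyC4v) (d k R : ℕ) {α' α : ℝ}
    (hcol' : ∀ Y', ∑ X', ‖klLipCov (b * L) M β μ K d k X' Y'‖ ≤ α') (hcol : ∀ Y, ∑ X, ‖klLipCov L M β μ K d k X Y‖ ≤ α)
    (Y' : SpaceTimeIdx (b * L) M × SectorLeg (sectorCount (d * k - 1))) :
    ∑ X', ‖klLipDefectFar L b M β μ K d k R X' Y'‖ ≤ α' + α := by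
  classical
  exact sum_norm_far_col_le (klBlockEquiv L b M (sectorCount (d * k - 1))) (klLipCov L M β μ K d k) (klLipCov (b * L) M β μ K d k)
    (klCopiesCov L b M (sectorCount (d * k - 1)) (klLipCov L M β μ K d k)) (klLipDefectFar L b M β μ K d k R)
    {Z' | Z' ∉ klDeepPins L R} (klCopiesCov_klLipCov_apply β μ K d k) (klLipDefectFar_apply' β μ K d k R) hcol' hcol Y'

/-- **The far piece lives on the zone** in the `hfar` shape of the defect step (`¬ (X′ ∈ Zs ∧ Y′ ∈ Zs) → D_f X′ Y′ = 0`). -/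
theorem klLipDefectFar_apply_of_not_zone (β μ : ℝ) (K : TrigPolyC4v) (d k R : ℕ) (X' Y' : SpaceTimeIdx (b * L) M × SectorLeg (sectorCount (d * k - 1)))
    (h : ¬ (X' ∈ {Z' : SpaceTimeIdx (b * L) M × SectorLeg (sectorCount (d * k - 1)) | Z' ∉ klDeepPins L R} ∧
            Y' ∈ {Z' : SpaceTimeIdx (b * L) M × SectorLeg (sectorCount (d * k - 1)) | Z' ∉ klDeepPins L R})) :
    klLipDefectFar L b M β μ K d k R X' Y' = 0 :=
  klLipDefectFar_apply_of_deep β μ K d k R h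

end Summit.HubbardSuperconductivity.HubbardSuperconductivity.Theorems.TwoVolumeLip

end
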